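import Literature.Probability.RandomPlanarGeometry.SLETraceEightOfUST
import Literature.Probability.RandomPlanarGeometry.SLETraceEightOfThm44
import Literature.Probability.RandomPlanarGeometry.LSW2004USTPeanoExistence
import Literature.Probability.RandomPlanarGeometry.LoewnerMapProofs
import Literature.Probability.RandomPlanarGeometry.SLEBoundaryHittingProofs
import Literature.Probability.RandomPlanarGeometry.CritPercSLESpaceFillingIffTraceEight
import Literature.Probability.Process.PathSpaceModulus
import HarnessLib

/-!
# [LSW04] Prop. 4.5 (uniform continuity of the UST Peano curve) from Lemma 4.6 and Thm. 4.4

G. F. Lawler, O. Schramm, W. Werner, *Conformal invariance of planar loop-erased random walks and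
uniform spanning trees*, Ann. Probab. **32** (2004) 939–995 (**[LSW04]**; arXiv:math/0112234,
where Prop. 4.5 = Prop. 24, Lemma 4.6 = Lemma 25, Thm. 4.4 = Thm. 23, Lemma 2.1 = Lemma 4).
Proof-only file: no definition, no named fact.

The tree proves [LSW04] Thm. 4.7 (`Literature.Probability.RandomPlanarGeometry.hasSLETrace_eight`,
"chordal SLE₈ traces a path") from exactly two probabilistic statements about the UST Peano
curve `γ̂ = φ_R ∘ γ` of the grid approximations `D^R` of a smooth domain (§4.3), both explicit
hypotheses of `USTPeano.hasSLETrace_eight_of_prop45_of_drivingProcess_tendsto`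
(`SLETraceEightOfUST.lean`): **Prop. 4.5** (p. 977, the uniform continuity estimate `h45`) and the
driving process convergence (named fact `USTPeano.drivingProcess_tendsto`, [LSW04] Thm. 4.4 as used
on p. 981). In [LSW04] Prop. 4.5 is itself DERIVED (pp. 978–979; arXiv p. 25, "Proof of
Proposition 4.5") from

* **Lemma 4.6** (p. 978): "For `0 < t₁ < t₂ < ∞` let `Y(t₁, t₂) := diam(g_{t₁} ∘ γ̂[t₁, t₂])`.
  For every `ε > 0` there is a `δ = δ(D, ε) > 0` and an `R₀ = R₀(D, ε) > 0` such that for all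
  `R ≥ R₀`, `P[sup{|γ̂(t₂) - γ̂(t₁)| : 0 ≤ t₁ ≤ t₂ ≤ τ, Y(t₁, t₂) ≤ δ} ≥ ε] < ε`, where
  `τ := inf{t ≥ 0 : |γ̂(t)| = ε⁻¹}`" — the genuinely discrete input (its proof uses Schramm
  (2000), Thms. 10.7, 11.1(ii) and Prop. 4.1);
* Thm. 4.4 (twice: a bound on `sup_{[0, t̄]} |W|`, and — "since Brownian motion is a.s.
  continuous" — a modulus of continuity of `W` on `[0, t̄]`, both with probability `≥ 1 - ε/4`
  for `R` large);
* Lemma 2.1 (diameter bounds on Loewner hulls, `diam K_t ≤ C (√t + sup_{s ≤ t} |W(s) - W(0)|)`)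
  "applied to the path `t ↦ g_{t₁} ∘ γ̂(t + t₁) - W(t₁)`", i.e. to the hulls of the time-shifted
  driving function `W(t₁ + ·)`, which bounds `Y(t₁, t₂)` by `C (√(t₂ - t₁) + osc_{[t₁, t₂]} W)`.

This file is that derivation, with everything except Lemma 4.6 PROVED:

* `USTPeano.prop45_of_lemma46_of_drivingProcess_tendsto` — **Prop. 4.5 (the hypothesis `h45`,
  verbatim) from Lemma 4.6 and `drivingProcess_tendsto`**. Lemma 4.6 enters as the explicit
  hypothesis `h46`, in the setting of `USTPeanoSetting.lean` and in the shape in which the printed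
  proof CONSUMES it after Lemma 2.1: the smallness condition "`Y(t₁, t₂) ≤ δ`" is rendered on the
  Loewner side as "`√(t₂ - t₁) ≤ δ` and `|W(s) - W(t₁)| ≤ δ` for `s ∈ [t₁, t₂]`". By [LSW04]
  Lemma 2.1 (= the tree's `Loewner.hull_subset_closedBall_driving`, Lawler's Lemma 4.13) these
  force the hull at time `t₂ - t₁` of the shifted chain, driving function `W(t₁ + ·)`, into the
  closed disc of radius `5δ` about `W(t₁)` (`USTPeano.hull_shift_subset_closedBall_of_osc`); for
  the simple curves `γ̂` at hand that hull is `g_{t₁}(γ̂(t₁, t₂])` (hull cocycle, the tree's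
  `Loewner.mem_hull_iff_map_mem_hull` / `Loewner.hull_shift_eq_image_incrCurve`, Lawler (2005),
  Rem. 4.9) and `g_{t₁}(γ̂(t₁)) = W(t₁)`, so `Y(t₁, t₂) ≤ 10δ`: the printed Lemma 4.6 implies `h46`
  with `δ = δ_print / 10`. The stopping condition "`t₂ ≤ τ`" is rendered as "`|γ̂(s)| < ε⁻¹` for
  all `s ≤ t₂`" (which implies it), "`sup{…} ≥ ε`" as the existence of such a pair `t₁ ≤ t₂`
  with `ε ≤ |γ̂(t₁) - γ̂(t₂)|` (a sub-event), and "for all `R ≥ R₀`" as "for all `R > R₀`" (as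
  in `h45`); in each case the event of `h46` is contained in the printed one, so `h46` is a
  consequence of Lemma 4.6 as printed. A second version
  `USTPeano.prop45_of_lemma46hull_of_drivingProcess_tendsto` takes Lemma 4.6 with the smallness
  condition on the hull itself ("the hull of `W(t₁ + ·)` at time `t₂ - t₁` lies in the closed
  disc of radius `δ` about `W(t₁)`"; then `Y ≤ 2δ`, so it follows from the printed lemma with
  `δ = δ_print / 2`, and it implies the first form by Lemma 2.1,
  `USTPeano.lemma46osc_of_lemma46hull`).
* Consequences: `USTPeano.hasSLETrace_eight_of_lemma46_of_drivingProcess_tendsto`,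
  `USTPeano.hasSLETrace_eight_of_lemma46_of_thm44` (Thm. 4.4 in its printed coupling shape, via
  `USTPeano.drivingProcess_tendsto_of_thm44'`), and for Rohde–Schramm's Cor. 7.4 with its Update
  (`Literature.Probability.RandomPlanarGeometry.ae_isSpaceFilling_sleTrace_of_eight_le`, whose only missing input is
  `hasSLETrace_eight`): `ae_isSpaceFilling_sleTrace_of_eight_le_of_lemma46_of_drivingProcess_tendsto`.

So after this file the inputs of `hasSLETrace_eight` not in the tree are exactly [LSW04]
Lemma 4.6 and Thm. 4.4 (the latter already reduced to the discrete key estimate Prop. 4.2 by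
`DrivingConvergenceEngine.lean`).

## The proof (pp. 978–979), as formalised

Along a sequence of approximations `Δₙ` at scales `Rₙ → ∞` (`prop45_seq_of_lemma46_of_drivingProcess_tendsto`):
the laws of the driving processes `Wₙ` converge to the law `μ` of `t ↦ B(8t)`
(`drivingProcess_tendsto`, portmanteau form `ProbabilityMeasure.limsup_measure_closed_le_of_tendsto`
on the closed sets below). (1) The sets `{w | ∃ s ≤ t̄, r ≤ |w(s)|}` are closed and decrease to
`∅` as `r → ∞`, so `μ` of one of them is `< ε/4`, hence eventually so for the law of `Wₙ`.
(2) Off that set `|γ̂(s)| ≤ r + 4√t̄ =: r̃` for `s ≤ t̄` (the curve lies in the closed hull,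
`Loewner.IsGeneratedByCurve.image_Icc_subset_closure_hull`, and the hull in the disc of radius
`sup|W| + 4√t̄`, `Loewner.hull_subset_closedBall_driving`); apply Lemma 4.6 with
`ε' := min{ε/4, 1/(r̃ + 1)}` (printed: "`ε' := min{ε, r⁻¹}`"; the `ε/4` makes the four error
terms add up to `< ε`, the `r̃` makes `τ ≥ t̄` off the bad set), getting `R₀` and `δ'`. (3) The
bad-modulus sets `{w | ∃ s, s' ≤ t̄, |s - s'| ≤ δ₀, δ'/2 ≤ |w(s) - w(s')|}` are closed and have
`μ`-measure `→ 0` as `δ₀ → 0` (`Process.tendsto_measure_badModulusSet`, Brownian paths being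
continuous), so for some `δ₀ ≤ δ'²` eventually the law of `Wₙ` charges it by `< ε/4`. (4) For `n`
large (`Rₙ > R₀` as well), on the event of Prop. 4.5 with this `δ₀` and off the two bad sets, the
pair `t₁ ≤ t₂` satisfies all constraints of the Lemma 4.6 event at `(ε', δ')`; so the probability
is `< ε/4 + ε/4 + ε' ≤ 3ε/4`. Finally the printed quantifier shape ("there are `R₀`, `δ` such
that for all `R > R₀`") follows from the sequential statement by contradiction
(`prop45_of_lemma46_of_drivingProcess_tendsto`).

## References

* [LSW04] Lemma 2.1 (p. 947), Thm. 4.4 (p. 976), Prop. 4.5 and Lemma 4.6 (pp. 977–979), proof of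
  Thm. 4.7 (p. 981) [LawlerSchrammWerner2004].
* G. F. Lawler, *Conformally Invariant Processes in the Plane* (2005), Lemma 4.13 [Lawler2005].
* P. Billingsley, *Convergence of Probability Measures*, 2nd ed. (1999), Thm. 2.1 (portmanteau),
  Thm. 7.3 [Billingsley1999].
-/

noncomputable section

open Set Filter MeasureTheory Metric Complex
open _root_.Topology
open UpperHalfPlane (upperHalfPlaneSet)
open scoped NNReal ENNReal

namespace Literature.Probability.RandomPlanarGeometry

open scoped PathBorel

namespace USTPeano

/-! ### Two closed subsets of the driving-path space -/

/-- The set of paths reaching level `r` in absolute value by time `T`,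
`{w | ∃ s ≤ T, r ≤ |w(s)|}`, is closed in `C([0, ∞), ℝ)` (locally uniform topology): along
`xₙ → y` with witnesses `sₙ ≤ T`, a subsequence of the times converges and the evaluations follow
(`Process.tendsto_apply_of_tendsto`). [folklore] -/
theorem isClosed_setOf_exists_le_abs (T r : ℝ) :
    IsClosed {w : C(ℝ≥0, ℝ) | ∃ s : ℝ≥0, (s : ℝ) ≤ T ∧ r ≤ |w s|} := by
  refine IsSeqClosed.isClosed fun x y hx hlim ↦ ?_
  choose s hs hr using hx
  obtain ⟨s₀, hs₀, φ, hφ, hsφ⟩ := (Process.isCompact_setOf_coe_le T).tendsto_subseq hs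
  have hlim' : Tendsto (x ∘ φ) atTop (𝓝 y) := hlim.comp hφ.tendsto_atTop
  have h1 : Tendsto (fun n ↦ (x ∘ φ) n ((s ∘ φ) n)) atTop (𝓝 (y s₀)) :=
    Process.tendsto_apply_of_tendsto hlim' (fun n ↦ hs _) hsφ
  exact ⟨s₀, hs₀, ge_of_tendsto' ((continuous_abs.tendsto _).comp h1) fun n ↦ hr _⟩

/-- For a finite Borel measure `μ` on `C([0, ∞), ℝ)`, `μ {w | ∃ s ≤ T, m + 1 ≤ |w(s)|} → 0` as
`m → ∞`: the sets decrease to `∅` since every path is bounded on `[0, T]`. (For the law of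
`B(8t)` this is "we may find some `r > 0` such that `P[sup{|W(t)| : t ∈ [0, t̄]} ≥ r] < ε/4`",
[LSW04] p. 979, in the limit.) [cite: LawlerSchrammWerner2004, proof of Prop. 4.5] -/
theorem tendsto_measure_setOf_exists_le_abs (μ : Measure C(ℝ≥0, ℝ)) [IsFiniteMeasure μ]
    (T : ℝ) :
    Tendsto (fun m : ℕ ↦ μ {w : C(ℝ≥0, ℝ) | ∃ s : ℝ≥0, (s : ℝ) ≤ T ∧ (m : ℝ) + 1 ≤ |w s|})
      atTop (𝓝 0) := by
  have hanti : Antitone fun m : ℕ ↦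
      {w : C(ℝ≥0, ℝ) | ∃ s : ℝ≥0, (s : ℝ) ≤ T ∧ (m : ℝ) + 1 ≤ |w s|} := by
    intro m m' hmm' w hw
    obtain ⟨s, hs, hr⟩ := hw
    have hle : (m : ℝ) + 1 ≤ (m' : ℝ) + 1 := by exact_mod_cast Nat.add_le_add_right hmm' 1
    exact ⟨s, hs, hle.trans hr⟩
  have hempty : ⋂ m : ℕ, {w : C(ℝ≥0, ℝ) | ∃ s : ℝ≥0, (s : ℝ) ≤ T ∧ (m : ℝ) + 1 ≤ |w s|} = ∅ := by
    ext w
    simp only [mem_iInter, mem_setOf_eq, mem_empty_iff_false, iff_false, not_forall, not_exists,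
      not_and, not_le]
    have hcont : ContinuousOn (fun s : ℝ≥0 ↦ |w s|) {s : ℝ≥0 | (s : ℝ) ≤ T} :=
      (continuous_abs.comp w.continuous).continuousOn
    obtain ⟨C, hC⟩ := (Process.isCompact_setOf_coe_le T).bddAbove_image hcont
    obtain ⟨m, hm⟩ := exists_nat_gt C
    refine ⟨m, fun s hs ↦ ?_⟩
    have h1 : |w s| ≤ C := hC ⟨s, hs, rfl⟩
    linarith
  have h := tendsto_measure_iInter_atTop (μ := μ)
    (fun m ↦ (isClosed_setOf_exists_le_abs T _).measurableSet.nullMeasurableSet) hanti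
    ⟨0, measure_ne_top μ _⟩
  rw [hempty, measure_empty] at h
  exact h

/-! ### The deterministic Loewner input (Lemma 2.1) -/

/-- **The curve is controlled by the driving function** ([LSW04] Lemma 2.1, upper bound, for a
chain generated by a curve from `0`): if `|W(s)| ≤ r` for `s ≤ T` (`T > 0`) then `|γ(s)| ≤ r + 4√T`
for `s ≤ T` — the curve lies in the closed hull `K̄_T`
(`Loewner.IsGeneratedByCurve.image_Icc_subset_closure_hull`) and `K_T` in the closed disc of radius
`sup_{s ≤ T} |W(s) - W(0)| + 4√T` about `W(0) = γ(0) = 0` (`Loewner.hull_subset_closedBall_driving`,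
Lawler (2005), Lemma 4.13). [cite: LawlerSchrammWerner2004, Lemma 2.1] [cite: Lawler2005, Lemma 4.13] -/
theorem norm_curve_le_of_abs_driving_le {W : ℝ≥0 → ℝ} {γ : ℝ≥0 → ℂ} (hW : Continuous W)
    (hγ : Loewner.IsGeneratedByCurve W γ) (h0 : γ 0 = 0) {T : ℝ≥0} (hT : 0 < T) {r : ℝ}
    (hr : ∀ s : ℝ≥0, s ≤ T → |W s| ≤ r) {s : ℝ≥0} (hs : s ≤ T) :
    ‖γ s‖ ≤ r + 4 * Real.sqrt T := by
  have hW0 : W 0 = 0 := by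
    have h := hγ.apply_zero
    rw [h0] at h
    exact_mod_cast h.symm
  have hS : ∀ u : ℝ≥0, u ≤ T → |W u - W 0| ≤ r := fun u hu ↦ by
    rw [hW0, sub_zero]
    exact hr u hu
  have h1 : γ s ∈ closure (Loewner.hull W T) :=
    hγ.image_Icc_subset_closure_hull hW hT ⟨s, ⟨bot_le, hs⟩, rfl⟩
  have h2 : closure (Loewner.hull W T) ⊆ closedBall ((W 0 : ℝ) : ℂ) (r + 4 * Real.sqrt T) :=
    closure_minimal (Loewner.hull_subset_closedBall_driving hW hS) isClosed_closedBall
  have h3 := h2 h1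
  rw [mem_closedBall, hW0, Complex.ofReal_zero, dist_zero_right] at h3
  exact h3

/-- **Lemma 2.1 applied to the shifted chain** ("Lemma 2.1 applied to the path
`t ↦ g_{t₁} ∘ γ̂(t + t₁) - W(t₁)`", [LSW04] p. 979): if `√(t₂ - t₁) ≤ δ` and `|W(s) - W(t₁)| ≤ δ`
for `s ∈ [t₁, t₂]`, then the hull at time `t₂ - t₁` of the chain driven by `W(t₁ + ·)` lies in
the closed disc of radius `5δ` about `W(t₁)`. [cite: LawlerSchrammWerner2004, Lemma 2.1]
[cite: Lawler2005, Lemma 4.13] -/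
theorem hull_shift_subset_closedBall_of_osc (W : C(ℝ≥0, ℝ)) {t₁ t₂ : ℝ≥0} (h12 : t₁ ≤ t₂) {δ : ℝ}
    (hsqrt : Real.sqrt ((t₂ : ℝ) - t₁) ≤ δ)
    (hosc : ∀ s : ℝ≥0, t₁ ≤ s → s ≤ t₂ → |W s - W t₁| ≤ δ) :
    Loewner.hull (fun s ↦ W (t₁ + s)) (t₂ - t₁) ⊆ closedBall ((W t₁ : ℝ) : ℂ) (5 * δ) := by
  have hW : Continuous fun s : ℝ≥0 ↦ W (t₁ + s) :=
    W.continuous.comp (continuous_const.add continuous_id)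
  have hS : ∀ s : ℝ≥0, s ≤ t₂ - t₁ →
      |(fun s : ℝ≥0 ↦ W (t₁ + s)) s - (fun s : ℝ≥0 ↦ W (t₁ + s)) 0| ≤ δ := fun s hs ↦ by
    simp only [add_zero]
    exact hosc (t₁ + s) le_self_add ((le_tsub_iff_left h12).1 hs)
  refine (Loewner.hull_subset_closedBall_driving hW hS).trans ?_
  simp only [add_zero]
  refine closedBall_subset_closedBall ?_
  rw [NNReal.coe_sub h12]
  linarith

/-! ### Prop. 4.5 along a sequence of approximations -/

/-- **[LSW04] Prop. 4.5 from Lemma 4.6 and Thm. 4.4, sequential form** (proof of Prop. 4.5,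
pp. 978–979). Along grid approximations `Δₙ` of a smooth domain `D` at scales `Rₙ → ∞` (§4.3),
with normalised maps `φₙ` and capacity images `(Γₙ, Wₙ)` of the Peano paths: if Lemma 4.6 holds
(hypothesis `h46`, in the post-Lemma-2.1 shape described in the module docstring: for every smooth
`D` and `ε > 0` there are `R₀`, `δ > 0` such that for every approximation `D^R`, `R > R₀`, every
normalised `φ` and capacity images `(γ̂, W)`,
`P[∃ t₁ ≤ t₂ : (∀ s ≤ t₂, |γ̂(s)| < ε⁻¹) ∧ √(t₂ - t₁) ≤ δ ∧ (∀ s ∈ [t₁, t₂], |W(s) - W(t₁)| ≤ δ)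
∧ ε ≤ |γ̂(t₁) - γ̂(t₂)|] < ε`) and the driving processes converge (`drivingProcess_tendsto`),
then for all `ε, t̄ > 0` there is `δ > 0` with, for all large `n`,
`P[∃ t₁, t₂ ≤ t̄, |t₁ - t₂| ≤ δ, ε < |γ̂(t₁) - γ̂(t₂)|] < ε`. See the module docstring for the
four steps. [cite: LawlerSchrammWerner2004, Prop. 4.5] -/
theorem prop45_seq_of_lemma46_of_drivingProcess_tendsto
    (h46 : ∀ (D : SmoothDomain) (ε : ℝ), 0 < ε →
      ∃ R₀ δ : ℝ, 0 < δ ∧ ∀ (R : ℝ) (Δ : Domain), R₀ < R → IsApproximation D R Δ →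
        ∀ (φ : ConformalEquiv upperHalfPlaneSet Δ.carrier), Δ.IsLSWMap φ →
          ∀ (Γ : PeanoPath Δ → C(ℝ≥0, ℂ)) (W : PeanoPath Δ → C(ℝ≥0, ℝ)),
            (∀ γ, IsCapacityImage Δ φ γ (Γ γ) (W γ)) →
              ustLaw Δ {γ | ∃ t₁ t₂ : ℝ≥0, t₁ ≤ t₂ ∧ (∀ s : ℝ≥0, s ≤ t₂ → ‖Γ γ s‖ < ε⁻¹) ∧
                Real.sqrt ((t₂ : ℝ) - t₁) ≤ δ ∧
                (∀ s : ℝ≥0, t₁ ≤ s → s ≤ t₂ → |W γ s - W γ t₁| ≤ δ) ∧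
                ε ≤ dist (Γ γ t₁) (Γ γ t₂)} < ENNReal.ofReal ε)
    (h44 : drivingProcess_tendsto)
    (D : SmoothDomain) (R : ℕ → ℝ) (Δ : ℕ → Domain) (hR : Tendsto R atTop atTop)
    (hΔ : ∀ n, IsApproximation D (R n) (Δ n))
    (φ : ∀ n, ConformalEquiv upperHalfPlaneSet (Δ n).carrier)
    (Γ : ∀ n, PeanoPath (Δ n) → C(ℝ≥0, ℂ)) (W : ∀ n, PeanoPath (Δ n) → C(ℝ≥0, ℝ))
    (hφ : ∀ n, (Δ n).IsLSWMap (φ n))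
    (hΓW : ∀ n γ, IsCapacityImage (Δ n) (φ n) γ (Γ n γ) (W n γ))
    {ε T : ℝ} (hε : 0 < ε) (hT : 0 < T) :
    ∃ δ : ℝ, 0 < δ ∧ ∀ᶠ n in atTop,
      ustLaw (Δ n) {γ | ∃ t₁ t₂ : ℝ≥0, (t₁ : ℝ) ≤ T ∧ (t₂ : ℝ) ≤ T ∧
        dist t₁ t₂ ≤ δ ∧ ε < dist (Γ n γ t₁) (Γ n γ t₂)} < ENNReal.ofReal ε := by
  classical
  haveI : Fact Process.isProjectiveLimit_preWienerMeasure :=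
    ⟨isProjectiveLimit_preWienerMeasure_holds'⟩
  haveI hne : ∀ n, Nonempty (PeanoPath (Δ n)) := fun n ↦ nonempty_peanoPath_holds (Δ n)
  haveI : ∀ n, IsProbabilityMeasure (ustLaw (Δ n)) := fun n ↦ inferInstance
  have hWm : ∀ n, AEMeasurable (W n) (ustLaw (Δ n)) := fun n ↦
    (Measurable.of_discrete).aemeasurable
  have hBm : AEMeasurable brownianTimeEight Process.preWienerMeasure :=
    measurable_brownianTimeEight.aemeasurable
  -- the law of `B(8t)` on path space and the laws of the driving processes
  set μB : Measure C(ℝ≥0, ℝ) := Process.preWienerMeasure.map brownianTimeEight with hμB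
  haveI : IsProbabilityMeasure μB := Measure.isProbabilityMeasure_map hBm
  set μ : ProbabilityMeasure C(ℝ≥0, ℝ) := ⟨μB, inferInstance⟩ with hμ
  set μs : ℕ → ProbabilityMeasure C(ℝ≥0, ℝ) :=
    fun n ↦ ⟨(ustLaw (Δ n)).map (W n), Measure.isProbabilityMeasure_map (hWm n)⟩ with hμs
  -- p. 981: "Theorem 4.4 implies that the law of `W` converges weakly to the law of `B(8t)`"
  have hlim : Tendsto μs atTop (𝓝 μ) := by
    rw [ProbabilityMeasure.tendsto_iff_forall_integral_tendsto]
    intro f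
    have key := h44 D R Δ hR hΔ hne φ Γ W (fun n ↦ ⟨hφ n, hΓW n⟩) f
    have h1 : ∀ n, ∫ x, f x ∂((ustLaw (Δ n)).map (W n)) = ∫ γ, f (W n γ) ∂ustLaw (Δ n) :=
      fun n ↦ integral_map (hWm n) f.continuous.aestronglyMeasurable
    have h2 : ∫ x, f x ∂μB = ∫ ω, f (brownianTimeEight ω) ∂Process.preWienerMeasure :=
      integral_map hBm f.continuous.aestronglyMeasurable
    simp only [hμs, hμ, ProbabilityMeasure.coe_mk, h1, h2]
    exact key
  -- portmanteau on closed sets: `μB F < c` ⇒ eventually `P[Wₙ ∈ F] < c`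
  have hport : ∀ (F : Set C(ℝ≥0, ℝ)), IsClosed F → ∀ (c : ℝ≥0∞), μB F < c →
      ∀ᶠ n in atTop, ustLaw (Δ n) {γ | W n γ ∈ F} < c := by
    intro F hF c hc
    have h := ProbabilityMeasure.limsup_measure_closed_le_of_tendsto hlim hF
    have h' : limsup (fun n ↦ (μs n : Measure C(ℝ≥0, ℝ)) F) atTop < c :=
      h.trans_lt (by simpa only [hμ, ProbabilityMeasure.coe_mk] using hc)
    filter_upwards [Filter.eventually_lt_of_limsup_lt h'] with n hn
    have h3 : (μs n : Measure C(ℝ≥0, ℝ)) F = ustLaw (Δ n) {γ | W n γ ∈ F} := by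
      simp only [hμs, ProbabilityMeasure.coe_mk]
      rw [Measure.map_apply_of_aemeasurable (hWm n) hF.measurableSet]
      rfl
    rwa [h3] at hn
  have hε4 : (0 : ℝ≥0∞) < ENNReal.ofReal (ε / 4) := ENNReal.ofReal_pos.2 (by linarith)
  -- Step 1: a level `r` not reached by `|W|` before `T`, with probability `> 1 - ε/4`
  obtain ⟨m₁, hm₁⟩ :=
    ((tendsto_measure_setOf_exists_le_abs μB T).eventually (gt_mem_nhds hε4)).exists
  set r : ℝ := (m₁ : ℝ) + 1 with hr
  have hr0 : 0 < r := by positivity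
  have hev1 := hport _ (isClosed_setOf_exists_le_abs T r) _ hm₁
  -- Step 2: Lemma 4.6 at `ε' = min (ε/4) (1/(r̃ + 1))`, `r̃ = r + 4√T`
  set rγ : ℝ := r + 4 * Real.sqrt T with hrγ
  have hrγ0 : 0 < rγ + 1 := by positivity
  set ε' : ℝ := min (ε / 4) (1 / (rγ + 1)) with hε'
  have hε'0 : 0 < ε' := lt_min (by linarith) (by positivity)
  have hε'ε : ε' ≤ ε / 4 := min_le_left _ _
  have hε'r : rγ + 1 ≤ ε'⁻¹ := by
    rw [← one_div, le_div_iff₀ hε'0]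
    have h1 : ε' ≤ 1 / (rγ + 1) := min_le_right _ _
    rw [le_div_iff₀ hrγ0] at h1
    linarith
  obtain ⟨R₀, δ', hδ', H46⟩ := h46 D ε' hε'0
  -- Step 3: a modulus of continuity of `W` on `[0, T]` at level `δ'/2`, probability `> 1 - ε/4`
  have hδ'2 : 0 < δ' / 2 := half_pos hδ'
  obtain ⟨m₀, hm₀⟩ := exists_nat_one_div_lt (sq_pos_of_pos hδ')
  obtain ⟨m₂, hm₂, hm₂'⟩ := (((Process.tendsto_measure_badModulusSet μB T hδ'2).eventually
    (gt_mem_nhds hε4)).and (eventually_ge_atTop m₀)).exists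
  set δ₀ : ℝ := 1 / ((m₂ : ℝ) + 1) with hδ₀
  have hδ₀0 : 0 < δ₀ := by positivity
  have hδ₀le : δ₀ ≤ δ' ^ 2 :=
    le_trans (one_div_le_one_div_of_le (by positivity) (by exact_mod_cast Nat.add_le_add_right hm₂' 1))
      hm₀.le
  have hev2 := hport _ (Process.isClosed_badModulusSet T δ₀ (δ' / 2)) _ hm₂
  -- Step 4: large `n`
  have hev3 : ∀ᶠ n in atTop, R₀ < R n := hR.eventually_gt_atTop R₀
  refine ⟨δ₀, hδ₀0, ?_⟩
  filter_upwards [hev1, hev2, hev3] with n hn1 hn2 hn3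
  have key46 := H46 (R n) (Δ n) hn3 (hΔ n) (φ n) (hφ n) (Γ n) (W n) (hΓW n)
  obtain ⟨T', hT'eq⟩ : ∃ T' : ℝ≥0, (T' : ℝ) = T := ⟨⟨T, hT.le⟩, rfl⟩
  have hT'0 : 0 < T' := by
    rw [← NNReal.coe_pos, hT'eq]
    exact hT
  have hcoeT : ∀ s : ℝ≥0, (s : ℝ) ≤ T ↔ s ≤ T' := fun s ↦ by
    rw [← NNReal.coe_le_coe, hT'eq]
  -- the containment of events
  have hsub : {γ : PeanoPath (Δ n) | ∃ t₁ t₂ : ℝ≥0, (t₁ : ℝ) ≤ T ∧ (t₂ : ℝ) ≤ T ∧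
        dist t₁ t₂ ≤ δ₀ ∧ ε < dist (Γ n γ t₁) (Γ n γ t₂)} ⊆
      ({γ | W n γ ∈ {w : C(ℝ≥0, ℝ) | ∃ s : ℝ≥0, (s : ℝ) ≤ T ∧ r ≤ |w s|}} ∪
        {γ | W n γ ∈ Process.badModulusSet T δ₀ (δ' / 2)}) ∪
      {γ | ∃ t₁ t₂ : ℝ≥0, t₁ ≤ t₂ ∧ (∀ s : ℝ≥0, s ≤ t₂ → ‖Γ n γ s‖ < ε'⁻¹) ∧
        Real.sqrt ((t₂ : ℝ) - t₁) ≤ δ' ∧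
        (∀ s : ℝ≥0, t₁ ≤ s → s ≤ t₂ → |W n γ s - W n γ t₁| ≤ δ') ∧
        ε' ≤ dist (Γ n γ t₁) (Γ n γ t₂)} := by
    intro γ hγ
    obtain ⟨t₁, t₂, ht₁, ht₂, hd, hεd⟩ := hγ
    by_cases hA : W n γ ∈ {w : C(ℝ≥0, ℝ) | ∃ s : ℝ≥0, (s : ℝ) ≤ T ∧ r ≤ |w s|}
    · exact Or.inl (Or.inl hA)
    by_cases hB : W n γ ∈ Process.badModulusSet T δ₀ (δ' / 2)
    · exact Or.inl (Or.inr hB)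
    refine Or.inr ?_
    -- off the bad sets: `|W| < r` on `[0, T]` and the modulus of continuity
    have hWr : ∀ s : ℝ≥0, s ≤ T' → |W n γ s| ≤ r := fun s hs ↦ by
      by_contra h
      exact hA ⟨s, (hcoeT s).2 hs, (not_le.1 h).le⟩
    have hmod : ∀ s t : ℝ≥0, (s : ℝ) ≤ T → (t : ℝ) ≤ T → dist s t ≤ δ₀ →
        dist (W n γ s) (W n γ t) < δ' / 2 := fun s t hs ht hst ↦ by
      by_contra h
      exact hB ⟨s, t, hs, ht, hst, not_lt.1 h⟩
    -- the curve stays below level `ε'⁻¹` up to time `T`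
    have hcurve : ∀ s : ℝ≥0, (s : ℝ) ≤ T → ‖Γ n γ s‖ < ε'⁻¹ := fun s hs ↦ by
      have h1 := norm_curve_le_of_abs_driving_le (W n γ).continuous (hΓW n γ).isGeneratedByCurve
        (hΓW n γ).apply_zero hT'0 hWr ((hcoeT s).1 hs)
      rw [hT'eq] at h1
      linarith
    -- the symmetric core
    have hcore : ∀ u₁ u₂ : ℝ≥0, u₁ ≤ u₂ → (u₁ : ℝ) ≤ T → (u₂ : ℝ) ≤ T → dist u₁ u₂ ≤ δ₀ →
        ε < dist (Γ n γ u₁) (Γ n γ u₂) →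
        ∃ t₁ t₂ : ℝ≥0, t₁ ≤ t₂ ∧ (∀ s : ℝ≥0, s ≤ t₂ → ‖Γ n γ s‖ < ε'⁻¹) ∧
          Real.sqrt ((t₂ : ℝ) - t₁) ≤ δ' ∧
          (∀ s : ℝ≥0, t₁ ≤ s → s ≤ t₂ → |W n γ s - W n γ t₁| ≤ δ') ∧
          ε' ≤ dist (Γ n γ t₁) (Γ n γ t₂) := by
      intro u₁ u₂ h12 hu₁ hu₂ hud hεu
      refine ⟨u₁, u₂, h12, fun s hs ↦ hcurve s ((NNReal.coe_le_coe.2 hs).trans hu₂), ?_, ?_, ?_⟩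
      · -- `√(u₂ - u₁) ≤ √δ₀ ≤ δ'`
        have h1 : (u₂ : ℝ) - u₁ ≤ δ₀ := by
          refine le_trans ?_ hud
          rw [NNReal.dist_eq, abs_sub_comm]
          exact le_abs_self _
        calc Real.sqrt ((u₂ : ℝ) - u₁) ≤ Real.sqrt (δ' ^ 2) :=
              Real.sqrt_le_sqrt (h1.trans hδ₀le)
          _ = δ' := Real.sqrt_sq hδ'.le
      · intro s h1s hs2
        have hsT : (s : ℝ) ≤ T := (NNReal.coe_le_coe.2 hs2).trans hu₂
        have hds : dist s u₁ ≤ δ₀ := by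
          refine le_trans ?_ hud
          rw [NNReal.dist_eq, NNReal.dist_eq,
            abs_of_nonneg (sub_nonneg.2 (NNReal.coe_le_coe.2 h1s)), abs_sub_comm,
            abs_of_nonneg (sub_nonneg.2 (NNReal.coe_le_coe.2 h12))]
          exact sub_le_sub_right (NNReal.coe_le_coe.2 hs2) _
        have h2 := hmod s u₁ hsT hu₁ hds
        rw [Real.dist_eq] at h2
        linarith
      · linarith
    rcases le_total t₁ t₂ with h12 | h12
    · exact hcore t₁ t₂ h12 ht₁ ht₂ hd hεd
    · exact hcore t₂ t₁ h12 ht₂ ht₁ (by rwa [dist_comm]) (by rwa [dist_comm])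
  -- the measure estimate
  have hfin : ENNReal.ofReal (ε / 4) + ENNReal.ofReal (ε / 4) + ENNReal.ofReal ε' ≤
      ENNReal.ofReal ε := by
    rw [← ENNReal.ofReal_add (by linarith) (by linarith),
      ← ENNReal.ofReal_add (by linarith) hε'0.le]
    exact ENNReal.ofReal_le_ofReal (by linarith)
  calc ustLaw (Δ n) {γ | ∃ t₁ t₂ : ℝ≥0, (t₁ : ℝ) ≤ T ∧ (t₂ : ℝ) ≤ T ∧
          dist t₁ t₂ ≤ δ₀ ∧ ε < dist (Γ n γ t₁) (Γ n γ t₂)}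
      ≤ ustLaw (Δ n) (({γ | W n γ ∈ {w : C(ℝ≥0, ℝ) | ∃ s : ℝ≥0, (s : ℝ) ≤ T ∧ r ≤ |w s|}} ∪
          {γ | W n γ ∈ Process.badModulusSet T δ₀ (δ' / 2)}) ∪
        {γ | ∃ t₁ t₂ : ℝ≥0, t₁ ≤ t₂ ∧ (∀ s : ℝ≥0, s ≤ t₂ → ‖Γ n γ s‖ < ε'⁻¹) ∧
          Real.sqrt ((t₂ : ℝ) - t₁) ≤ δ' ∧
          (∀ s : ℝ≥0, t₁ ≤ s → s ≤ t₂ → |W n γ s - W n γ t₁| ≤ δ') ∧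
          ε' ≤ dist (Γ n γ t₁) (Γ n γ t₂)}) := measure_mono hsub
    _ ≤ ustLaw (Δ n) {γ | W n γ ∈ {w : C(ℝ≥0, ℝ) | ∃ s : ℝ≥0, (s : ℝ) ≤ T ∧ r ≤ |w s|}} +
          ustLaw (Δ n) {γ | W n γ ∈ Process.badModulusSet T δ₀ (δ' / 2)} +
        ustLaw (Δ n) {γ | ∃ t₁ t₂ : ℝ≥0, t₁ ≤ t₂ ∧ (∀ s : ℝ≥0, s ≤ t₂ → ‖Γ n γ s‖ < ε'⁻¹) ∧
          Real.sqrt ((t₂ : ℝ) - t₁) ≤ δ' ∧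
          (∀ s : ℝ≥0, t₁ ≤ s → s ≤ t₂ → |W n γ s - W n γ t₁| ≤ δ') ∧
          ε' ≤ dist (Γ n γ t₁) (Γ n γ t₂)} :=
        (measure_union_le _ _).trans (add_le_add (measure_union_le _ _) le_rfl)
    _ < ENNReal.ofReal (ε / 4) + ENNReal.ofReal (ε / 4) + ENNReal.ofReal ε' :=
        ENNReal.add_lt_add (ENNReal.add_lt_add hn1 hn2) key46
    _ ≤ ENNReal.ofReal ε := hfin

/-! ### Prop. 4.5 in its printed quantifier shape -/

/-- **[LSW04] Prop. 4.5 (uniform continuity estimate) from Lemma 4.6 and Thm. 4.4.** Prop. 4.5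
(p. 977): "For every `ε > 0` and `t̄ > 0` there are some positive `R₀ = R₀(D, t̄, ε)` and
`δ = δ(D, t̄, ε)` such that for all `R > R₀`,
`P[sup{|γ̂(t₂) - γ̂(t₁)| : t₁, t₂ ∈ [0, t̄], |t₂ - t₁| ≤ δ} > ε] < ε`" — the conclusion is the
hypothesis `h45` of `USTPeano.hasSLETrace_eight_of_prop45_of_drivingProcess_tendsto`, verbatim.
Hypotheses: `h46` = Lemma 4.6 (p. 978) in the post-Lemma-2.1 shape (module docstring; implied by
the printed lemma, `δ = δ_print / 10`), `h44` = `drivingProcess_tendsto` (Thm. 4.4 as used on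
p. 981). From the sequential statement `prop45_seq_of_lemma46_of_drivingProcess_tendsto` by
contradiction: a failure for every `(R₀, δ) = (n, 1/(n+1))` produces approximations at scales
`Rₙ > n` violating it. [cite: LawlerSchrammWerner2004, Prop. 4.5] -/
theorem prop45_of_lemma46_of_drivingProcess_tendsto
    (h46 : ∀ (D : SmoothDomain) (ε : ℝ), 0 < ε →
      ∃ R₀ δ : ℝ, 0 < δ ∧ ∀ (R : ℝ) (Δ : Domain), R₀ < R → IsApproximation D R Δ →
        ∀ (φ : ConformalEquiv upperHalfPlaneSet Δ.carrier), Δ.IsLSWMap φ →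
          ∀ (Γ : PeanoPath Δ → C(ℝ≥0, ℂ)) (W : PeanoPath Δ → C(ℝ≥0, ℝ)),
            (∀ γ, IsCapacityImage Δ φ γ (Γ γ) (W γ)) →
              ustLaw Δ {γ | ∃ t₁ t₂ : ℝ≥0, t₁ ≤ t₂ ∧ (∀ s : ℝ≥0, s ≤ t₂ → ‖Γ γ s‖ < ε⁻¹) ∧
                Real.sqrt ((t₂ : ℝ) - t₁) ≤ δ ∧
                (∀ s : ℝ≥0, t₁ ≤ s → s ≤ t₂ → |W γ s - W γ t₁| ≤ δ) ∧
                ε ≤ dist (Γ γ t₁) (Γ γ t₂)} < ENNReal.ofReal ε)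
    (h44 : drivingProcess_tendsto) :
    ∀ (D : SmoothDomain) (ε t : ℝ), 0 < ε → 0 < t →
      ∃ R₀ δ : ℝ, 0 < δ ∧ ∀ (R : ℝ) (Δ : Domain), R₀ < R → IsApproximation D R Δ →
        ∀ (φ : ConformalEquiv upperHalfPlaneSet Δ.carrier), Δ.IsLSWMap φ →
          ∀ (Γ : PeanoPath Δ → C(ℝ≥0, ℂ)) (W : PeanoPath Δ → C(ℝ≥0, ℝ)),
            (∀ γ, IsCapacityImage Δ φ γ (Γ γ) (W γ)) →
              ustLaw Δ {γ | ∃ t₁ t₂ : ℝ≥0, (t₁ : ℝ) ≤ t ∧ (t₂ : ℝ) ≤ t ∧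
                dist t₁ t₂ ≤ δ ∧ ε < dist (Γ γ t₁) (Γ γ t₂)} < ENNReal.ofReal ε := by
  intro D ε T hε hT
  by_contra hcon
  push Not at hcon
  have h1 : ∀ n : ℕ, ∃ (R : ℝ) (Δ : Domain) (φ : ConformalEquiv upperHalfPlaneSet Δ.carrier)
      (Γ : PeanoPath Δ → C(ℝ≥0, ℂ)) (W : PeanoPath Δ → C(ℝ≥0, ℝ)),
      (n : ℝ) < R ∧ IsApproximation D R Δ ∧ Δ.IsLSWMap φ ∧
        (∀ γ, IsCapacityImage Δ φ γ (Γ γ) (W γ)) ∧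
        ENNReal.ofReal ε ≤ ustLaw Δ {γ | ∃ t₁ t₂ : ℝ≥0, (t₁ : ℝ) ≤ T ∧ (t₂ : ℝ) ≤ T ∧
          dist t₁ t₂ ≤ 1 / ((n : ℝ) + 1) ∧ ε < dist (Γ γ t₁) (Γ γ t₂)} := by
    intro n
    obtain ⟨R, Δ, hR, hΔ, φ, hφ, Γ, W, hΓW, hP⟩ := hcon n (1 / ((n : ℝ) + 1)) (by positivity)
    exact ⟨R, Δ, φ, Γ, W, hR, hΔ, hφ, hΓW, hP⟩
  choose R Δ φ Γ W hRn hΔ hφ hΓW hP using h1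
  have hR : Tendsto R atTop atTop :=
    tendsto_atTop_mono (fun n ↦ (hRn n).le) tendsto_natCast_atTop_atTop
  obtain ⟨δ, hδ, hev⟩ := prop45_seq_of_lemma46_of_drivingProcess_tendsto h46 h44 D R Δ hR hΔ
    φ Γ W hφ hΓW hε hT
  obtain ⟨m, hm⟩ := exists_nat_one_div_lt hδ
  obtain ⟨n, hn, hmn⟩ := (hev.and (eventually_ge_atTop m)).exists
  have hle : 1 / ((n : ℝ) + 1) ≤ δ :=
    le_trans (one_div_le_one_div_of_le (by positivity) (by exact_mod_cast Nat.add_le_add_right hmn 1))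
      hm.le
  have hmono : ustLaw (Δ n) {γ | ∃ t₁ t₂ : ℝ≥0, (t₁ : ℝ) ≤ T ∧ (t₂ : ℝ) ≤ T ∧
        dist t₁ t₂ ≤ 1 / ((n : ℝ) + 1) ∧ ε < dist (Γ n γ t₁) (Γ n γ t₂)} ≤
      ustLaw (Δ n) {γ | ∃ t₁ t₂ : ℝ≥0, (t₁ : ℝ) ≤ T ∧ (t₂ : ℝ) ≤ T ∧
        dist t₁ t₂ ≤ δ ∧ ε < dist (Γ n γ t₁) (Γ n γ t₂)} := by
    refine measure_mono fun γ hγ ↦ ?_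
    obtain ⟨t₁, t₂, h1, h2, h3, h4⟩ := hγ
    exact ⟨t₁, t₂, h1, h2, h3.trans hle, h4⟩
  exact absurd hn (not_lt.2 ((hP n).trans hmono))

/-! ### Lemma 4.6 with the smallness condition on the hull -/

/-- **The hull form of Lemma 4.6 implies the form used above** (with `δ/5`): if `√(t₂ - t₁) ≤ δ/5`
and `|W(s) - W(t₁)| ≤ δ/5` on `[t₁, t₂]`, the hull of `W(t₁ + ·)` at time `t₂ - t₁` lies in the
closed `δ`-disc about `W(t₁)` (`hull_shift_subset_closedBall_of_osc`, [LSW04] Lemma 2.1), so the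
event of the first form at `δ/5` is contained in the event of the hull form at `δ`.
[cite: LawlerSchrammWerner2004, Lemma 4.6 and Lemma 2.1] -/
theorem lemma46osc_of_lemma46hull
    (h46 : ∀ (D : SmoothDomain) (ε : ℝ), 0 < ε →
      ∃ R₀ δ : ℝ, 0 < δ ∧ ∀ (R : ℝ) (Δ : Domain), R₀ < R → IsApproximation D R Δ →
        ∀ (φ : ConformalEquiv upperHalfPlaneSet Δ.carrier), Δ.IsLSWMap φ →
          ∀ (Γ : PeanoPath Δ → C(ℝ≥0, ℂ)) (W : PeanoPath Δ → C(ℝ≥0, ℝ)),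
            (∀ γ, IsCapacityImage Δ φ γ (Γ γ) (W γ)) →
              ustLaw Δ {γ | ∃ t₁ t₂ : ℝ≥0, t₁ ≤ t₂ ∧ (∀ s : ℝ≥0, s ≤ t₂ → ‖Γ γ s‖ < ε⁻¹) ∧
                Loewner.hull (fun s ↦ W γ (t₁ + s)) (t₂ - t₁) ⊆
                  closedBall ((W γ t₁ : ℝ) : ℂ) δ ∧
                ε ≤ dist (Γ γ t₁) (Γ γ t₂)} < ENNReal.ofReal ε) :
    ∀ (D : SmoothDomain) (ε : ℝ), 0 < ε →
      ∃ R₀ δ : ℝ, 0 < δ ∧ ∀ (R : ℝ) (Δ : Domain), R₀ < R → IsApproximation D R Δ →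
        ∀ (φ : ConformalEquiv upperHalfPlaneSet Δ.carrier), Δ.IsLSWMap φ →
          ∀ (Γ : PeanoPath Δ → C(ℝ≥0, ℂ)) (W : PeanoPath Δ → C(ℝ≥0, ℝ)),
            (∀ γ, IsCapacityImage Δ φ γ (Γ γ) (W γ)) →
              ustLaw Δ {γ | ∃ t₁ t₂ : ℝ≥0, t₁ ≤ t₂ ∧ (∀ s : ℝ≥0, s ≤ t₂ → ‖Γ γ s‖ < ε⁻¹) ∧
                Real.sqrt ((t₂ : ℝ) - t₁) ≤ δ ∧
                (∀ s : ℝ≥0, t₁ ≤ s → s ≤ t₂ → |W γ s - W γ t₁| ≤ δ) ∧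
                ε ≤ dist (Γ γ t₁) (Γ γ t₂)} < ENNReal.ofReal ε := by
  intro D ε hε
  obtain ⟨R₀, δ, hδ, H⟩ := h46 D ε hε
  refine ⟨R₀, δ / 5, by positivity, fun R Δ hR hΔ φ hφ Γ W hΓW ↦ ?_⟩
  refine lt_of_le_of_lt (measure_mono ?_) (H R Δ hR hΔ φ hφ Γ W hΓW)
  intro γ hγ
  obtain ⟨t₁, t₂, h12, hτ, hsqrt, hosc, hε'⟩ := hγ
  refine ⟨t₁, t₂, h12, hτ, ?_, hε'⟩
  have h := hull_shift_subset_closedBall_of_osc (W γ) h12 hsqrt hosc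
  have h5 : 5 * (δ / 5) = δ := by ring
  rwa [h5] at h

/-- **[LSW04] Prop. 4.5 from Lemma 4.6 (hull form) and Thm. 4.4.** As
`prop45_of_lemma46_of_drivingProcess_tendsto`, with Lemma 4.6 taken in the hull form: the
smallness condition "`Y(t₁, t₂) = diam(g_{t₁} ∘ γ̂[t₁, t₂]) ≤ δ`" rendered as "the hull at time
`t₂ - t₁` of the chain driven by `W(t₁ + ·)` — which is `g_{t₁}(γ̂(t₁, t₂])`, rooted at
`W(t₁) = g_{t₁}(γ̂(t₁))`, cf. `Loewner.hull_shift_eq_image_incrCurve` — lies in the closed disc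
of radius `δ` about `W(t₁)`" (so that `Y ≤ 2δ`: the printed lemma implies this hypothesis with
`δ = δ_print / 2`).
[cite: LawlerSchrammWerner2004, Prop. 4.5 and Lemma 4.6] -/
theorem prop45_of_lemma46hull_of_drivingProcess_tendsto
    (h46 : ∀ (D : SmoothDomain) (ε : ℝ), 0 < ε →
      ∃ R₀ δ : ℝ, 0 < δ ∧ ∀ (R : ℝ) (Δ : Domain), R₀ < R → IsApproximation D R Δ →
        ∀ (φ : ConformalEquiv upperHalfPlaneSet Δ.carrier), Δ.IsLSWMap φ →
          ∀ (Γ : PeanoPath Δ → C(ℝ≥0, ℂ)) (W : PeanoPath Δ → C(ℝ≥0, ℝ)),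
            (∀ γ, IsCapacityImage Δ φ γ (Γ γ) (W γ)) →
              ustLaw Δ {γ | ∃ t₁ t₂ : ℝ≥0, t₁ ≤ t₂ ∧ (∀ s : ℝ≥0, s ≤ t₂ → ‖Γ γ s‖ < ε⁻¹) ∧
                Loewner.hull (fun s ↦ W γ (t₁ + s)) (t₂ - t₁) ⊆
                  closedBall ((W γ t₁ : ℝ) : ℂ) δ ∧
                ε ≤ dist (Γ γ t₁) (Γ γ t₂)} < ENNReal.ofReal ε)
    (h44 : drivingProcess_tendsto) :
    ∀ (D : SmoothDomain) (ε t : ℝ), 0 < ε → 0 < t →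
      ∃ R₀ δ : ℝ, 0 < δ ∧ ∀ (R : ℝ) (Δ : Domain), R₀ < R → IsApproximation D R Δ →
        ∀ (φ : ConformalEquiv upperHalfPlaneSet Δ.carrier), Δ.IsLSWMap φ →
          ∀ (Γ : PeanoPath Δ → C(ℝ≥0, ℂ)) (W : PeanoPath Δ → C(ℝ≥0, ℝ)),
            (∀ γ, IsCapacityImage Δ φ γ (Γ γ) (W γ)) →
              ustLaw Δ {γ | ∃ t₁ t₂ : ℝ≥0, (t₁ : ℝ) ≤ t ∧ (t₂ : ℝ) ≤ t ∧
                dist t₁ t₂ ≤ δ ∧ ε < dist (Γ γ t₁) (Γ γ t₂)} < ENNReal.ofReal ε :=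
  prop45_of_lemma46_of_drivingProcess_tendsto (lemma46osc_of_lemma46hull h46) h44

/-! ### Consequences for [LSW04] Thm. 4.7 -/

/-- **[LSW04] Thm. 4.7 (SLE₈ is generated by a curve) from Lemma 4.6 and `drivingProcess_tendsto`**:
`hasSLETrace_eight_of_prop45_of_drivingProcess_tendsto` with Prop. 4.5 supplied by
`prop45_of_lemma46_of_drivingProcess_tendsto`. [cite: LawlerSchrammWerner2004, Thm. 4.7] -/
theorem hasSLETrace_eight_of_lemma46_of_drivingProcess_tendsto
    (h46 : ∀ (D : SmoothDomain) (ε : ℝ), 0 < ε →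
      ∃ R₀ δ : ℝ, 0 < δ ∧ ∀ (R : ℝ) (Δ : Domain), R₀ < R → IsApproximation D R Δ →
        ∀ (φ : ConformalEquiv upperHalfPlaneSet Δ.carrier), Δ.IsLSWMap φ →
          ∀ (Γ : PeanoPath Δ → C(ℝ≥0, ℂ)) (W : PeanoPath Δ → C(ℝ≥0, ℝ)),
            (∀ γ, IsCapacityImage Δ φ γ (Γ γ) (W γ)) →
              ustLaw Δ {γ | ∃ t₁ t₂ : ℝ≥0, t₁ ≤ t₂ ∧ (∀ s : ℝ≥0, s ≤ t₂ → ‖Γ γ s‖ < ε⁻¹) ∧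
                Real.sqrt ((t₂ : ℝ) - t₁) ≤ δ ∧
                (∀ s : ℝ≥0, t₁ ≤ s → s ≤ t₂ → |W γ s - W γ t₁| ≤ δ) ∧
                ε ≤ dist (Γ γ t₁) (Γ γ t₂)} < ENNReal.ofReal ε)
    (h44 : drivingProcess_tendsto) : hasSLETrace_eight :=
  hasSLETrace_eight_of_prop45_of_drivingProcess_tendsto
    (prop45_of_lemma46_of_drivingProcess_tendsto h46 h44) h44

/-- **[LSW04] Thm. 4.7 from Lemma 4.6 (hull form) and `drivingProcess_tendsto`.**
[cite: LawlerSchrammWerner2004, Thm. 4.7] -/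
theorem hasSLETrace_eight_of_lemma46hull_of_drivingProcess_tendsto
    (h46 : ∀ (D : SmoothDomain) (ε : ℝ), 0 < ε →
      ∃ R₀ δ : ℝ, 0 < δ ∧ ∀ (R : ℝ) (Δ : Domain), R₀ < R → IsApproximation D R Δ →
        ∀ (φ : ConformalEquiv upperHalfPlaneSet Δ.carrier), Δ.IsLSWMap φ →
          ∀ (Γ : PeanoPath Δ → C(ℝ≥0, ℂ)) (W : PeanoPath Δ → C(ℝ≥0, ℝ)),
            (∀ γ, IsCapacityImage Δ φ γ (Γ γ) (W γ)) →
              ustLaw Δ {γ | ∃ t₁ t₂ : ℝ≥0, t₁ ≤ t₂ ∧ (∀ s : ℝ≥0, s ≤ t₂ → ‖Γ γ s‖ < ε⁻¹) ∧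
                Loewner.hull (fun s ↦ W γ (t₁ + s)) (t₂ - t₁) ⊆
                  closedBall ((W γ t₁ : ℝ) : ℂ) δ ∧
                ε ≤ dist (Γ γ t₁) (Γ γ t₂)} < ENNReal.ofReal ε)
    (h44 : drivingProcess_tendsto) : hasSLETrace_eight :=
  hasSLETrace_eight_of_lemma46_of_drivingProcess_tendsto (lemma46osc_of_lemma46hull h46) h44

/-- **[LSW04] Thm. 4.7 from Lemma 4.6 and Thm. 4.4 as printed** (the coupling statement of
p. 976, hypothesis `h44` in the shape of `USTPeano.drivingProcess_tendsto_of_thm44'` /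
`USTPeano.hasSLETrace_eight_of_prop45_of_thm44`): so the two inputs of Thm. 4.7 still outside the
tree are exactly Lemma 4.6 and Thm. 4.4. [cite: LawlerSchrammWerner2004, Thm. 4.7] -/
theorem hasSLETrace_eight_of_lemma46_of_thm44
    (h46 : ∀ (D : SmoothDomain) (ε : ℝ), 0 < ε →
      ∃ R₀ δ : ℝ, 0 < δ ∧ ∀ (R : ℝ) (Δ : Domain), R₀ < R → IsApproximation D R Δ →
        ∀ (φ : ConformalEquiv upperHalfPlaneSet Δ.carrier), Δ.IsLSWMap φ →
          ∀ (Γ : PeanoPath Δ → C(ℝ≥0, ℂ)) (W : PeanoPath Δ → C(ℝ≥0, ℝ)),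
            (∀ γ, IsCapacityImage Δ φ γ (Γ γ) (W γ)) →
              ustLaw Δ {γ | ∃ t₁ t₂ : ℝ≥0, t₁ ≤ t₂ ∧ (∀ s : ℝ≥0, s ≤ t₂ → ‖Γ γ s‖ < ε⁻¹) ∧
                Real.sqrt ((t₂ : ℝ) - t₁) ≤ δ ∧
                (∀ s : ℝ≥0, t₁ ≤ s → s ≤ t₂ → |W γ s - W γ t₁| ≤ δ) ∧
                ε ≤ dist (Γ γ t₁) (Γ γ t₂)} < ENNReal.ofReal ε)
    (h44 : ∀ (ε₁ ε₂ ε₃ T : ℝ), 0 < ε₁ → 0 < ε₂ → 0 < ε₃ → 0 < T → ∃ r₁ : ℝ, ∀ (Δ : Domain),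
      (0 : ℂ) ∈ Δ.carrier → ball (0 : ℂ) r₁ ⊆ Δ.carrier →
      ∀ (φ : ConformalEquiv upperHalfPlaneSet Δ.carrier), Δ.IsLSWMap φ →
        ε₁ * Real.pi ≤ arg (φ.symm 0) → arg (φ.symm 0) ≤ (1 - ε₁) * Real.pi →
        ∀ (Γ : PeanoPath Δ → C(ℝ≥0, ℂ)) (W : PeanoPath Δ → C(ℝ≥0, ℝ)),
          (∀ γ, IsCapacityImage Δ φ γ (Γ γ) (W γ)) →
          ∃ ρ : Measure (C(ℝ≥0, ℝ) × C(ℝ≥0, ℝ)), ρ.fst = (ustLaw Δ).map W ∧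
            ρ.snd = Process.preWienerMeasure.map brownianTimeEight ∧
            ρ {p | ∃ t : ℝ≥0, (t : ℝ) ≤ T ∧ ε₂ < dist (p.1 t) (p.2 t)} < ENNReal.ofReal ε₃) :
    hasSLETrace_eight :=
  hasSLETrace_eight_of_lemma46_of_drivingProcess_tendsto h46 (drivingProcess_tendsto_of_thm44' h44)

end USTPeano

/-! ### Consequence for Rohde–Schramm's Cor. 7.4 with its Update (`κ = 8`) -/

/-- **`ae_isSpaceFilling_sleTrace_of_eight_le` (every `κ`, i.e. Rohde–Schramm (2005), Cor. 7.4 with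
the Update "true also for `κ = 8`") from [LSW04] Lemma 4.6 and `drivingProcess_tendsto`**: the
named fact needs only `hasSLETrace_eight`
(`ae_isSpaceFilling_sleTrace_of_eight_le_of_hasSLETrace_eight`), which
`USTPeano.hasSLETrace_eight_of_lemma46_of_drivingProcess_tendsto` provides.
[cite: RohdeSchramm2005, Cor. 7.4 and Update (p. 911)] [cite: LawlerSchrammWerner2004, Thm. 4.7] -/
theorem ae_isSpaceFilling_sleTrace_of_eight_le_of_lemma46_of_drivingProcess_tendsto {κ : ℝ≥0}
    (h46 : ∀ (D : USTPeano.SmoothDomain) (ε : ℝ), 0 < ε →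
      ∃ R₀ δ : ℝ, 0 < δ ∧ ∀ (R : ℝ) (Δ : USTPeano.Domain), R₀ < R →
        USTPeano.IsApproximation D R Δ →
        ∀ (φ : ConformalEquiv upperHalfPlaneSet Δ.carrier), Δ.IsLSWMap φ →
          ∀ (Γ : USTPeano.PeanoPath Δ → C(ℝ≥0, ℂ)) (W : USTPeano.PeanoPath Δ → C(ℝ≥0, ℝ)),
            (∀ γ, USTPeano.IsCapacityImage Δ φ γ (Γ γ) (W γ)) →
              USTPeano.ustLaw Δ {γ | ∃ t₁ t₂ : ℝ≥0, t₁ ≤ t₂ ∧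
                (∀ s : ℝ≥0, s ≤ t₂ → ‖Γ γ s‖ < ε⁻¹) ∧
                Real.sqrt ((t₂ : ℝ) - t₁) ≤ δ ∧
                (∀ s : ℝ≥0, t₁ ≤ s → s ≤ t₂ → |W γ s - W γ t₁| ≤ δ) ∧
                ε ≤ dist (Γ γ t₁) (Γ γ t₂)} < ENNReal.ofReal ε)
    (h44 : USTPeano.drivingProcess_tendsto) :
    ae_isSpaceFilling_sleTrace_of_eight_le (κ := κ) :=
  ae_isSpaceFilling_sleTrace_of_eight_le_of_hasSLETrace_eight
    (USTPeano.hasSLETrace_eight_of_lemma46_of_drivingProcess_tendsto h46 h44)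

end Literature.Probability.RandomPlanarGeometry
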